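import Mathlib
import Literature.Analysis.FluidPDE.LinearizedNSTorus
import Literature.Analysis.FluidPDE.LerayProjectorTorusProofs
import Literature.Analysis.FunctionSpaces.TorusFluidGlue
import HarnessLib

/-!
# PeriodicNSOrbitPersists

Topic `Literature/Analysis/FluidPDE`. Named literature fact(s) relocated by the gate from `Summits/AnomalousDissipation/AnomalousDissipation/Theorems/BaireTransferRobustLoudUpgradePeriodicPersistOfHenry.lean`
(accept-time relocation of `[cite]`d propositions written inline in a Summits proposal; human ruling 2026-08-15).
Sources: Henry1981.

* `Literature.Analysis.FluidPDE.PeriodicNSOrbitPersists`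
-/

namespace Literature.Analysis.FluidPDE

open scoped BigOperators Topology
open Filter Set Function TopologicalSpace MeasureTheory
open Literature.Analysis.FunctionSpaces Literature.Analysis.FunctionSpaces.Torus
open Literature.Analysis.FluidPDE

/-- **Persistence of a nondegenerate time-periodic orbit of the Navier–Stokes flow on `T³` under a
small change of the steady body force, at fixed viscosity** (D. Henry 1981).

Let `(u, p)` be a classical solution of `NS_ν(f)` on `ℝ × T³` (`ν > 0`, `f` time independent)
which is `τ`-periodic in time (`τ > 0`) and NONDEGENERATE, i.e. the Floquet multiplier `1` of the
linearisation along `u` (in the conserved-mean leaf) is simple: (i) every jointly smooth,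
divergence-free, mean-zero, `τ`-periodic solution `(w, q)` of the linearised problem
`∂ₜw = νΔw − (u·∇)w − (w·∇)u − ∇q` is a complex multiple of `∂ₜu`, and (ii) the inhomogeneous
problem `∂ₜw = νΔw − (u·∇)w − (w·∇)u − ∇q + ∂ₜu` has NO such solution (no `τ`-periodic Jordan
partner of `∂ₜu`; (ii) also excludes steady `u`).  Then for every `δ > 0` there is `r > 0` such that
every smooth divergence-free mean-zero force `f'` with `‖f' − f‖_∞ ≤ r` carries a `τ'`-periodic
(`τ' > 0`) classical solution `(u', p')` of `NS_ν(f')` on `ℝ × T³` whose orbit stays, uniformly in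
time and after the linear time rescaling matching the periods, within `δ` of `u` in `L² ∩ Ḣ¹`:
`∫‖u'(t) − u(τt/τ')‖² + ‖∇(u'(t) − u(τt/τ'))‖₂² ≤ δ` for all `t`.

This is Henry's perturbation theorem for a periodic orbit of an autonomous semilinear sectorial
evolution equation `ẋ + Ax = g(x, λ)` whose multiplier `1` is simple (implicit function theorem for
the period map with the period as extra unknown; the orbit and its period depend continuously on
the parameter, uniformly in time in `X^α`), applied to `NS_ν` on the affine invariant leaf
`{mean u = const}` of `L²_σ(T³)` with `A` = Stokes operator, `3/4 < α < 1`, the force entering as an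
additive parameter in `L²_σ` (so sup-norm closeness of `f'` to `f` suffices, the non-solenoidal part
of `f` being absorbed in the pressure); the period map of the linearisation is compact (`A` has
compact resolvent), so (i)+(ii) say exactly that `1` is an algebraically simple eigenvalue, the
(generalised) eigenvectors being jointly smooth by parabolic regularity; the classical `C^∞`
phrasing of the conclusion (with pressure) is parabolic regularity of time-periodic mild solutions
with smooth force plus the smooth Helmholtz decomposition, and the `Ḣ¹` closeness is `X^α ↪ H¹_σ`
(`α ≥ 1/2`) combined with `|τ' − τ|` small and the Lipschitz continuity of `t ↦ u(t)` in `X^α`.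
Secondary sources for the Navier–Stokes case: Iooss, Arch. Rational Mech. Anal. 47 (1972)
(Floquet theory at a time-periodic flow); Yudovich, *The Linearization Method in Hydrodynamical
Stability Theory* (1989), Ch. II.
[cite: Henry1981, Ch. 8 §8.2–8.3] [topic Analysis/FluidPDE] -/
def PeriodicNSOrbitPersists : Prop :=
  ∀ (ν τ : ℝ) (f : UnitAddTorus (Fin 3) → EuclideanSpace ℝ (Fin 3))
    (u : ℝ → UnitAddTorus (Fin 3) → EuclideanSpace ℝ (Fin 3)) (p : ℝ → UnitAddTorus (Fin 3) → ℝ),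
    0 < ν → 0 < τ →
    Literature.Analysis.FunctionSpaces.Torus.IsClassicalNSSolutionOn Set.univ ν (fun _ => f) u p →
    Function.Periodic u τ →
    (∀ (w : ℝ → UnitAddTorus (Fin 3) → EuclideanSpace ℂ (Fin 3)) (q : ℝ → UnitAddTorus (Fin 3) → ℂ),
        Literature.Analysis.FunctionSpaces.Torus.IsSmoothSpaceTimeOn Set.univ w →
        Literature.Analysis.FunctionSpaces.Torus.IsSmoothSpaceTimeOn Set.univ q →
        (∀ t, Literature.Analysis.FluidPDE.Torus.IsDivFreeC (w t)) →
        (∀ t, Literature.Analysis.FunctionSpaces.Torus.HasZeroMean (w t)) →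
        Function.Periodic w τ →
        (∀ t x, Literature.Analysis.FunctionSpaces.Torus.timeDerivWithin Set.univ w t x =
          Literature.Analysis.FluidPDE.Torus.linearizedNSOperator ν (u t) (w t) (q t) x) →
        ∃ z : ℂ, ∀ t x, w t x = z • Literature.Analysis.FluidPDE.Torus.realToComplex
          (Literature.Analysis.FunctionSpaces.Torus.timeDerivWithin Set.univ u t x)) →
    (∀ (w : ℝ → UnitAddTorus (Fin 3) → EuclideanSpace ℂ (Fin 3)) (q : ℝ → UnitAddTorus (Fin 3) → ℂ),
        Literature.Analysis.FunctionSpaces.Torus.IsSmoothSpaceTimeOn Set.univ w →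
        Literature.Analysis.FunctionSpaces.Torus.IsSmoothSpaceTimeOn Set.univ q →
        (∀ t, Literature.Analysis.FluidPDE.Torus.IsDivFreeC (w t)) →
        (∀ t, Literature.Analysis.FunctionSpaces.Torus.HasZeroMean (w t)) →
        Function.Periodic w τ →
        ∃ t x, Literature.Analysis.FunctionSpaces.Torus.timeDerivWithin Set.univ w t x ≠
          Literature.Analysis.FluidPDE.Torus.linearizedNSOperator ν (u t) (w t) (q t) x +
            Literature.Analysis.FluidPDE.Torus.realToComplex
              (Literature.Analysis.FunctionSpaces.Torus.timeDerivWithin Set.univ u t x)) →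
    ∀ δ : ℝ, 0 < δ → ∃ r : ℝ, 0 < r ∧
      ∀ f' : UnitAddTorus (Fin 3) → EuclideanSpace ℝ (Fin 3),
        Literature.Analysis.FunctionSpaces.Torus.IsSmooth f' →
        Literature.Analysis.FunctionSpaces.Torus.IsDivFree f' →
        Literature.Analysis.FunctionSpaces.Torus.HasZeroMean f' → (∀ x, ‖f' x - f x‖ ≤ r) →
        ∃ (τ' : ℝ) (u' : ℝ → UnitAddTorus (Fin 3) → EuclideanSpace ℝ (Fin 3))
          (p' : ℝ → UnitAddTorus (Fin 3) → ℝ), 0 < τ' ∧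
          Literature.Analysis.FunctionSpaces.Torus.IsClassicalNSSolutionOn Set.univ ν (fun _ => f')
            u' p' ∧ Function.Periodic u' τ' ∧
          ∀ t, (∫ x, ‖u' t x - u (τ / τ' * t) x‖ ^ 2) +
            Literature.Analysis.FunctionSpaces.Torus.gradNormSq (fun x => u' t x - u (τ / τ' * t) x) ≤ δ

/-! ## §2 The force map `c ↦ f_c`: differences and sup-norm continuity -/

end Literature.Analysis.FluidPDE
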